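import Literature.Computability.Complexity.UmansFPRoots
import HarnessLib

/-!
# Umans' generator, machine level VI: the root finder runs in polynomial time (`CodeFP`)

Literature / circuit complexity — derandomization. Sixth machine-level file of the tree's proof of
C. Umans, JCSS 2003, Thm. 6; machine side of `UmansFPRoots.lean`. The breadth-first Roth–Ruckenstein
loop `UmansFP.rrLevelsL c elems cap t Ql` on lists of bitmask coefficient lists is computed on
codes by a polynomial-time string function:

* the primitives on codes: `atZeroLC`, `bIsZeroC`, `bMaxLenC`, `xvalLC`, `stripXLC`, `mulSC`,
  `addHeadC`, `shiftYLC`, `childQLC`, `rootsLKC`, `rrExpandLC`;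
* UNCONDITIONAL size invariants (every input, reduced or not): row counts, row lengths
  (`shiftYL_rows`: Horner adds at most one coefficient per row and round), entries (brick outputs are
  below `2ᵂ`), the frontier cap and the path lengths along the levels (`rrLevelsL_inv`);
* **`rrLevelsLC`**: `(c, elems, 1^cap, 1ᵗ, Ql) ↦ rrLevelsL c elems cap t Ql`, the two loops by
  `CodeFP.foldl` with those invariants as the polynomial accumulator bounds.

Everything is proved; no named fact.

## References

* R. M. Roth, G. Ruckenstein, IEEE Trans. Inform. Theory 46 (2000), §V–VI [RothRuckenstein2000].
* S. Arora, B. Barak, *Computational Complexity: A Modern Approach*, CUP 2009, §1.3 [AroraBarak2009].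
-/

noncomputable section

namespace Literature.Computability.Complexity

open Polynomial Literature.InformationTheory.Coding
open Literature.InformationTheory.Coding.GF2X CodeFP

namespace UmansFP

/-! ### Unconditional sizes -/

section Bounds

variable (c : ℕ × ℕ × ℕ)

/-- All rows at most `B` long. [folklore] -/
def RowsLe (B : ℕ) (Ql : List (List ℕ)) : Prop := ∀ r ∈ Ql, r.length ≤ B

/-- All entries of all rows at most `2ᵂ`. [folklore] -/
def RowsBnd (W : ℕ) (Ql : List (List ℕ)) : Prop := ∀ r ∈ Ql, KBnd W r

/-- `bMaxLen` is below any common bound of the row lengths. [folklore] -/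
theorem bMaxLen_le_of_rowsLe {B : ℕ} {Ql : List (List ℕ)} (h : RowsLe B Ql) : bMaxLen Ql ≤ B := by
  unfold bMaxLen
  suffices H : ∀ (l : List ℕ) (b : ℕ), b ≤ B → (∀ x ∈ l, x ≤ B) → l.foldl max b ≤ B from
    H _ 0 (Nat.zero_le _) fun x hx => by obtain ⟨r, hr, rfl⟩ := List.mem_map.1 hx; exact h r hr
  intro l
  induction l with
  | nil => intro b hb _; exact hb
  | cons a l ih => intro b hb hl; exact ih _ (max_le hb (hl a List.mem_cons_self)) fun x hx => hl x (List.mem_cons_of_mem a hx)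

/-- Rows are at most `bMaxLen` long. [folklore] -/
theorem rowsLe_bMaxLen (Ql : List (List ℕ)) : RowsLe (bMaxLen Ql) Ql := fun _ hr => length_le_bMaxLen hr

/-- `bMaxLen` is at most the total length. [folklore] -/
theorem bMaxLen_le_flatten (Ql : List (List ℕ)) : bMaxLen Ql ≤ Ql.flatten.length :=
  bMaxLen_le_of_rowsLe fun r hr => by
    rw [List.length_flatten]; exact List.le_sum_of_mem (List.mem_map.2 ⟨r, hr, rfl⟩)

/-- `bMaxLen` is at most the code. [folklore] -/
theorem bMaxLen_le_code (Ql : List (List ℕ)) : bMaxLen Ql ≤ (rawE (rawE natE) Ql).length :=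
  bMaxLen_le_of_rowsLe fun r hr =>
    (length_le_length_rawE natE r).trans (by have := length_item_le_length_rawE (rawE natE) hr; omega)

/-- `xvalL ≤ bMaxLen`. [folklore] -/
theorem xvalL_le (Ql : List (List ℕ)) : xvalL Ql ≤ bMaxLen Ql := (foldl_min_spec _ _).1

/-- `stripXL`: as many rows, none longer, entries among the old ones. [folklore] -/
theorem stripXL_rows (Ql : List (List ℕ)) : (stripXL Ql).length = Ql.length ∧
    (∀ B, RowsLe B Ql → RowsLe B (stripXL Ql)) ∧ (∀ W, RowsBnd W Ql → RowsBnd W (stripXL Ql)) := by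
  refine ⟨List.length_map _, fun B h r hr => ?_, fun W h r hr x hx => ?_⟩
  · obtain ⟨r', hr', rfl⟩ := List.mem_map.1 hr
    rw [List.length_drop]; exact (Nat.sub_le _ _).trans (h r' hr')
  · obtain ⟨r', hr', rfl⟩ := List.mem_map.1 hr
    exact h r' hr' x (List.mem_of_mem_drop hx)

/-- `kpadd`: the longer length, entries below `2ᵂ`. [folklore] -/
theorem kpadd_bound (W : ℕ) (u v : List ℕ) : (kpadd W u v).length = max u.length v.length ∧ KBnd W (kpadd W u v) := by
  refine ⟨length_zipWithPad _ _ _ _ _, fun x hx => ?_⟩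
  obtain ⟨_, -, _, -, rfl⟩ := exists_of_mem_zipWith hx
  exact (xorW_lt _ _ _).le

/-- `mulS`: one more row, rows at most one longer, entries below `2ᵂ`. [folklore] -/
theorem mulS_rows (γ : ℕ) {B : ℕ} {R : List (List ℕ)} (h : RowsLe B R) :
    RowsLe (B + 1) (mulS c γ R) ∧ RowsBnd c.1 (mulS c γ R) := by
  have hA : ∀ a ∈ ([] :: R.map (List.cons 0)), a.length ≤ B + 1 := by
    intro a ha
    rcases List.mem_cons.1 ha with rfl | ha
    · simp
    · obtain ⟨r, hr, rfl⟩ := List.mem_map.1 ha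
      rw [List.length_cons]; exact Nat.succ_le_succ (h r hr)
  have hB : ∀ b ∈ (R.map (lsmul c γ) ++ [[]]), b.length ≤ B + 1 := by
    intro b hb
    rw [List.mem_append, List.mem_singleton] at hb
    rcases hb with hb | rfl
    · obtain ⟨r, hr, rfl⟩ := List.mem_map.1 hb
      rw [lsmul, List.length_map]; exact (h r hr).trans (Nat.le_succ _)
    · simp
  refine ⟨fun r hr => ?_, fun r hr => ?_⟩
  · obtain ⟨a, ha, b, hb, rfl⟩ := exists_of_mem_zipWith hr
    rw [(kpadd_bound _ _ _).1]; exact max_le (hA a ha) (hB b hb)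
  · obtain ⟨a, -, b, -, rfl⟩ := exists_of_mem_zipWith hr
    exact (kpadd_bound _ _ _).2

/-- `addHead`: as many rows, rows at most `max B |P|`, entries below `2ᵂ`. [folklore] -/
theorem addHead_rows {B : ℕ} {R : List (List ℕ)} (h : RowsLe B R) (P : List ℕ) :
    (addHead c R P).length = R.length ∧ RowsLe (max B P.length) (addHead c R P) ∧ RowsBnd c.1 (addHead c R P) := by
  refine ⟨by rw [addHead, List.length_zipWith, List.length_cons, List.length_replicate]; omega, fun r hr => ?_, fun r hr => ?_⟩
  · obtain ⟨a, ha, b, hb, rfl⟩ := exists_of_mem_zipWith hr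
    rw [(kpadd_bound _ _ _).1]
    refine max_le ((h a ha).trans (le_max_left _ _)) ?_
    rcases List.mem_cons.1 hb with rfl | hb
    · exact le_max_right _ _
    · rw [List.eq_of_mem_replicate hb]; exact Nat.zero_le _
  · obtain ⟨a, -, b, -, rfl⟩ := exists_of_mem_zipWith hr
    exact (kpadd_bound _ _ _).2

/-- **Horner adds at most one coefficient per row and round**: `shiftYL c γ Pl` has `|Pl|` rows,
each at most `bMaxLen Pl + |Pl|` long, with entries below `2ᵂ`. [folklore] -/
theorem shiftYL_rows (γ : ℕ) : ∀ (Pl : List (List ℕ)) (B : ℕ), RowsLe B Pl →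
    RowsLe (B + Pl.length) (shiftYL c γ Pl) ∧ RowsBnd c.1 (shiftYL c γ Pl)
  | [], _, _ => ⟨fun r hr => by simp [shiftYL] at hr, fun r hr => by simp [shiftYL] at hr⟩
  | P :: Pl, B, h => by
    obtain ⟨h1, -⟩ := shiftYL_rows γ Pl B fun r hr => h r (List.mem_cons_of_mem P hr)
    obtain ⟨hm, -⟩ := mulS_rows c γ h1
    obtain ⟨-, ha1, ha2⟩ := addHead_rows c hm P
    rw [shiftYL_cons]
    refine ⟨fun r hr => (ha1 r hr).trans (max_le (by rw [List.length_cons]; omega) ?_), ha2⟩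
    exact (h P List.mem_cons_self).trans (by omega)

/-- `childQL`: `|Ql|` rows, each at most `bMaxLen Ql + |Ql|` long, entries below `2ᵂ`. [folklore] -/
theorem childQL_rows (γ : ℕ) (Ql : List (List ℕ)) {B : ℕ} (h : RowsLe B Ql) :
    (childQL c γ Ql).length = Ql.length ∧ RowsLe (B + Ql.length) (childQL c γ Ql) ∧ RowsBnd c.1 (childQL c γ Ql) := by
  obtain ⟨hl, hle, -⟩ := stripXL_rows Ql
  obtain ⟨h1, h2⟩ := shiftYL_rows c γ (stripXL Ql) B (hle B h)
  rw [hl] at h1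
  exact ⟨by rw [childQL, length_shiftYL, hl], h1, h2⟩

/-- The invariant of a node after `k` levels from `Ql`. [folklore] -/
def NodeInv (elems : List ℕ) (Ql : List (List ℕ)) (k : ℕ) (nd : List ℕ × List (List ℕ)) : Prop :=
  nd.1.length ≤ k ∧ (∀ γ ∈ nd.1, γ ∈ elems) ∧ nd.2.length = Ql.length ∧
    RowsLe (bMaxLen Ql + k * Ql.length) nd.2 ∧ (nd.2 = Ql ∨ RowsBnd c.1 nd.2)

/-- Expansion keeps the invariant (one more level). [folklore] -/
theorem nodeInv_expand {elems : List ℕ} {Ql : List (List ℕ)} {k : ℕ} {nd : List ℕ × List (List ℕ)}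
    (h : NodeInv c elems Ql k nd) : ∀ nd' ∈ rrExpandL c elems nd, NodeInv c elems Ql (k + 1) nd' := by
  intro nd' hnd'
  obtain ⟨h1, h2, h3, h4, -⟩ := h
  unfold rrExpandL at hnd'
  split_ifs at hnd' with hz
  · simp at hnd'
  · obtain ⟨γ, hγ, rfl⟩ := List.mem_map.1 hnd'
    obtain ⟨c1, c2, c3⟩ := childQL_rows c γ nd.2 h4
    refine ⟨by rw [List.length_append, List.length_singleton]; omega, fun x hx => ?_, by rw [c1, h3], ?_, Or.inr c3⟩
    · rw [List.mem_append, List.mem_singleton] at hx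
      rcases hx with hx | rfl
      · exact h2 x hx
      · exact (List.mem_filter.1 hγ).1
    · intro r hr
      refine (c2 r hr).trans ?_
      rw [h3, add_mul, one_mul]; omega

/-- **The invariant of the levels**: at most `max 1 cap` nodes, each satisfying `NodeInv` at its level.
[folklore] -/
theorem rrLevelsL_inv (elems : List ℕ) (cap : ℕ) (Ql : List (List ℕ)) (u : List Unit) :
    (u.foldl (fun F _ => (F.flatMap (rrExpandL c elems)).take cap) [([], Ql)]).length ≤ max 1 cap ∧
      ∀ nd ∈ u.foldl (fun F _ => (F.flatMap (rrExpandL c elems)).take cap) [([], Ql)], NodeInv c elems Ql u.length nd := by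
  induction u using List.reverseRecOn with
  | nil =>
    refine ⟨by simp, fun nd hnd => ?_⟩
    simp only [List.foldl_nil, List.mem_singleton] at hnd
    subst hnd
    exact ⟨le_rfl, fun _ h => by simp at h, rfl, fun r hr => by simpa using length_le_bMaxLen hr, Or.inl rfl⟩
  | append_singleton u x ih =>
    rw [List.foldl_append, List.foldl_cons, List.foldl_nil, List.length_append, List.length_singleton]
    refine ⟨by rw [List.length_take]; omega, fun nd hnd => ?_⟩
    obtain ⟨nd₀, hnd₀, hmem⟩ := List.mem_flatMap.1 (List.mem_of_mem_take hnd)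
    exact nodeInv_expand c (ih.2 nd₀ hnd₀) nd hmem

/-- The code of a matrix with at most `n` rows, each at most `B` long with entries at most `2ᵂ`.
[folklore] -/
theorem length_code_rows_le {W B n : ℕ} {Q : List (List ℕ)} (hn : Q.length ≤ n) (hB : RowsLe B Q) (hW : RowsBnd W Q) :
    (rawE (rawE natE) Q).length ≤ n * (2 * (B * (2 * W + 4)) + 2) := by
  have h1 : ∀ r ∈ Q, (rawE natE r).length ≤ B * (2 * W + 4) := fun r hr =>
    (length_rawE_of_kbnd (hW r hr)).trans (Nat.mul_le_mul_right _ (hB r hr))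
  exact (length_rawE_rawE_le h1).trans (Nat.mul_le_mul_right _ hn)

/-- The code of a list with entries from `elems`. [folklore] -/
theorem length_code_path_le {elems p : List ℕ} {E : ℕ} (hE : ∀ γ ∈ elems, (natE γ).length ≤ E) (hp : ∀ γ ∈ p, γ ∈ elems) :
    (rawE natE p).length ≤ p.length * (2 * E + 2) := by
  induction p with
  | nil => simp
  | cons a p ih =>
    rw [rawE_cons, length_boolPair, List.length_cons, add_mul, one_mul]
    have := hE a (hp a List.mem_cons_self)
    have := ih fun x hx => hp x (List.mem_cons_of_mem a hx)
    omega

/-- `foldl max` is its start or one of the items. [folklore] -/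
theorem foldl_max_mem_or : ∀ (l : List ℕ) (b : ℕ), l.foldl max b = b ∨ l.foldl max b ∈ l
  | [], _ => Or.inl rfl
  | a :: l, b => by
    rw [List.foldl_cons]
    rcases foldl_max_mem_or l (max b a) with h | h
    · rw [h]
      rcases le_total a b with hab | hba
      · exact Or.inl (max_eq_left hab)
      · right; rw [max_eq_right hba]; exact List.mem_cons_self
    · exact Or.inr (List.mem_cons_of_mem a h)

/-- The raw code of a list whose items code in `≤ E` symbols. [folklore] -/
theorem length_rawE_le_of_forall {α : Type} {e : α → List Bool} {l : List α} {E : ℕ} (h : ∀ a ∈ l, (e a).length ≤ E) :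
    (rawE e l).length ≤ l.length * (2 * E + 2) := by
  rw [length_rawE]
  have : ∀ x ∈ l.map (fun a => 2 * (e a).length + 2), x ≤ 2 * E + 2 := fun x hx => by
    obtain ⟨a, ha, rfl⟩ := List.mem_map.1 hx
    have := h a ha; omega
  simpa using List.sum_le_card_nsmul _ _ this

end Bounds

/-! ### `CodeFP` certificates -/

section Machine

/-- The code of coefficient lists. -/
local notation "L" => rawE natE

/-- The code of matrices (lists of coefficient lists). -/
local notation "matE" => rawE (rawE natE)

/-- The code of nodes `(path, Q)`. -/
local notation "ndE" => pairE (rawE natE) (rawE (rawE natE))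

/-- **`Q(0, Y)` on codes.** [folklore] -/
theorem atZeroLC : CodeFP matE L atZeroL :=
  (map₀ ((rawHeadOr natE).comp ((const _ (0 : ℕ)).pair (CodeFP.id _)))).congr fun _ => rfl

/-- **The zero test on codes.** [folklore] -/
theorem bIsZeroC : CodeFP matE bitE bIsZero :=
  ((all (σ := Unit) (eσ := unitE) (eα := L) (p := fun t => kpIsZero t.2) (kpIsZeroC.comp (snd _ _))).comp
    ((const _ ()).pair (CodeFP.id _))).congr fun _ => rfl

/-- `foldl max 0` on codes. [folklore] -/
theorem foldlMaxC : CodeFP (rawE natE) natE (fun l => l.foldl max 0) := by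
  have h := foldl₀ (eα := natE) (eβ := natE) (step := fun (a b : ℕ) => max b a) (b₀ := (0 : ℕ))
    (natMax.comp ((snd _ _).pair (fst _ _))) X (fun l₁ l₂ => by
      rw [eval_X]
      rcases foldl_max_mem_or l₁ 0 with h | h
      · change (natE (l₁.foldl max 0)).length ≤ _
        rw [h, natE_zero]; exact Nat.zero_le _
      · change (natE (l₁.foldl max 0)).length ≤ _
        have := length_item_le_length_rawE natE (List.mem_append_left l₂ h)
        omega)
  exact h.congr fun _ => rfl

/-- **The widest row on codes.** [folklore] -/
theorem bMaxLenC : CodeFP matE natE bMaxLen := (foldlMaxC.comp (map₀ (natLength natE))).congr fun _ => rfl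

/-- `foldl min` from a given start, on codes. [folklore] -/
theorem foldlMinC : CodeFP (pairE natE (rawE natE)) natE (fun p => p.2.foldl min p.1) := by
  have h := foldl (σ := ℕ) (eσ := natE) (eα := natE) (eβ := natE) (step := fun (_ a b : ℕ) => min b a) (init := fun s => s)
    (natMin.comp ((snd _ _).snd'.pair (snd _ _).fst')) (CodeFP.id natE) X (fun s l₁ l₂ => by
      simp only [eval_X, pairE_apply, length_boolPair, length_natE]
      have h1 : l₁.foldl (fun b a => min b a) s ≤ s := (foldl_min_spec l₁ s).1
      have := Nat.size_le_size h1
      omega)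
  exact h.congr fun _ => rfl

/-- **The `X`-content exponent on codes.** [folklore] -/
theorem xvalLC : CodeFP matE natE xvalL := by
  have hnz : CodeFP matE matE (fun Ql => Ql.filter fun r => !kpIsZero r) :=
    ((filter (σ := Unit) (eσ := unitE) (eα := L) (p := fun t => !kpIsZero t.2) (kpIsZeroC.comp (snd _ _)).not).comp
      ((const _ ()).pair (CodeFP.id _))).congr fun _ => rfl
  exact (foldlMinC.comp (bMaxLenC.pair ((map₀ kpValC).comp hnz))).congr fun _ => rfl

/-- **`stripXL` on codes** (the drop count, at most the total length, is made unary against the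
flattened matrix). [folklore] -/
theorem stripXLC : CodeFP matE matE stripXL := by
  have hk : CodeFP matE unE (fun Ql => min (xvalL Ql) Ql.flatten.length) :=
    unOfNatMin.comp (((ulength natE).comp (flatten natE)).pair xvalLC)
  have hm := map (σ := ℕ) (eσ := unE) (eα := L) (eβ := L) (g := fun t => t.2.drop t.1) (rawDropUn natE)
  refine ((hm.comp (hk.pair (CodeFP.id _))).congr fun Ql => ?_)
  show Ql.map (fun r => r.drop (min (xvalL Ql) Ql.flatten.length)) = stripXL Ql
  rw [min_eq_left ((xvalL_le Ql).trans (bMaxLen_le_flatten Ql))]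
  rfl

/-- **Multiplication by `X·Y + γ` on codes.** [folklore] -/
theorem mulSC : CodeFP (pairE kctxE (pairE natE matE)) matE (fun t => mulS t.1 t.2.1 t.2.2) := by
  have hc : CodeFP (pairE kctxE (pairE natE matE)) kctxE (fun t => t.1) := fst _ _
  have hγ : CodeFP (pairE kctxE (pairE natE matE)) natE (fun t => t.2.1) := (snd _ _).fst'
  have hR : CodeFP (pairE kctxE (pairE natE matE)) matE (fun t => t.2.2) := (snd _ _).snd'
  have hA : CodeFP (pairE kctxE (pairE natE matE)) matE (fun t => ([] : List ℕ) :: t.2.2.map (List.cons 0)) :=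
    ((rawCons L).comp ((const _ ([] : List ℕ)).pair ((map₀ ((rawCons natE).comp ((const _ (0 : ℕ)).pair (CodeFP.id _)))).comp hR)) :)
  have hsm : CodeFP (pairE (pairE kctxE natE) L) L (fun t => lsmul t.1.1 t.1.2 t.2) :=
    (lsmulFP.comp ((fst _ _).fst'.pair ((fst _ _).snd'.pair (snd _ _))) :)
  have hB : CodeFP (pairE kctxE (pairE natE matE)) matE (fun t => t.2.2.map (lsmul t.1 t.2.1) ++ [([] : List ℕ)]) :=
    ((rawAppend L).comp (((map hsm).comp ((hc.pair hγ).pair hR)).pair (const _ [([] : List ℕ)])) :)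
  have hz := zipWith (σ := ℕ) (eσ := unE) (eα := L) (eβ := L) (eγ := L) (g := fun t => kpadd t.1 t.2.1 t.2.2) kpaddC
  exact ((hz.comp (hc.fst'.pair (hA.pair hB))).congr fun _ => rfl)

/-- **Adding to the `Y⁰`-coefficient on codes.** [folklore] -/
theorem addHeadC : CodeFP (pairE kctxE (pairE matE L)) matE (fun t => addHead t.1 t.2.1 t.2.2) := by
  have hR : CodeFP (pairE kctxE (pairE matE L)) matE (fun t => t.2.1) := (snd _ _).fst'
  have hP : CodeFP (pairE kctxE (pairE matE L)) L (fun t => t.2.2) := (snd _ _).snd'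
  have hD : CodeFP (pairE kctxE (pairE matE L)) matE (fun t => t.2.2 :: List.replicate t.2.1.length ([] : List ℕ)) :=
    ((rawCons L).comp (hP.pair ((replicateOf L).comp ((const _ ([] : List ℕ)).pair ((ulength L).comp hR)))) :)
  have hz := zipWith (σ := ℕ) (eσ := unE) (eα := L) (eβ := L) (eγ := L) (g := fun t => kpadd t.1 t.2.1 t.2.2) kpaddC
  exact ((hz.comp ((fst _ _).fst'.pair (hR.pair hD))).congr fun _ => rfl)

/-- The Horner loop from `[]` is `shiftYL` of the reversed list. [folklore] -/
theorem foldl_horner_eq (c : ℕ × ℕ × ℕ) (γ : ℕ) (l : List (List ℕ)) :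
    l.foldl (fun R P => addHead c (mulS c γ R) P) [] = shiftYL c γ l.reverse := by
  rw [shiftYL, List.reverse_reverse]

/-- **`Q(X, XY + γ)` on codes**: the Horner loop, whose accumulator has as many rows as processed,
each at most "widest row + rounds" long with entries below `2ᵂ`. [cite: AroraBarak2009, §1.3] -/
theorem shiftYLC : CodeFP (pairE kctxE (pairE natE matE)) matE (fun t => shiftYL t.1 t.2.1 t.2.2) := by
  let σE : (ℕ × ℕ × ℕ) × ℕ → List Bool := pairE kctxE natE
  have hstep : CodeFP (pairE σE (pairE L matE)) matE (fun t => addHead t.1.1 (mulS t.1.1 t.1.2 t.2.2) t.2.1) :=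
    (addHeadC.comp ((fst _ _).fst'.pair ((mulSC.comp ((fst _ _).fst'.pair ((fst _ _).snd'.pair (snd _ _).snd'))).pair
      (snd _ _).fst')) :)
  have h := foldl (eσ := σE) (eα := L) (eβ := matE)
    (step := fun (s : (ℕ × ℕ × ℕ) × ℕ) (P : List ℕ) (R : List (List ℕ)) => addHead s.1 (mulS s.1 s.2 R) P)
    (init := fun _ => ([] : List (List ℕ))) hstep (const _ []) (26 * (X + 1) ^ 3)
    (fun s l₁ l₂ => by
      obtain ⟨⟨W, f, P⟩, γ⟩ := s
      dsimp only
      rw [foldl_horner_eq]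
      set Lc := (pairE σE (rawE L) (((W, f, P), γ), l₁ ++ l₂)).length with hLc
      have hrows : RowsLe Lc l₁.reverse := fun r hr => by
        have h1 := length_item_le_length_rawE (rawE natE) (List.mem_append_left l₂ (List.mem_reverse.1 hr))
        have h2 := length_le_length_rawE natE r
        rw [hLc]; simp only [σE, pairE_apply, length_boolPair]; omega
      obtain ⟨h1, h2⟩ := shiftYL_rows (W, f, P) γ l₁.reverse Lc hrows
      have hl : l₁.length ≤ Lc := by
        have := length_le_length_rawE (rawE natE) (l₁ ++ l₂)
        rw [List.length_append] at this
        rw [hLc]; simp only [σE, pairE_apply, length_boolPair]; omega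
      have hW : W ≤ Lc := by rw [hLc]; simp only [σE, pairE_apply, length_boolPair, length_unE]; omega
      rw [List.length_reverse] at h1
      have hc := length_code_rows_le (n := Lc) (B := 2 * Lc) (W := Lc) (by rw [length_shiftYL, List.length_reverse]; exact hl)
        (fun r hr => (h1 r hr).trans (by omega)) (fun r hr x hx => (h2 r hr x hx).trans (Nat.pow_le_pow_right two_pos hW))
      refine hc.trans ?_
      simp only [eval_mul, eval_pow, eval_add, eval_X, eval_ofNat, eval_one]
      nlinarith [Nat.zero_le Lc, Nat.zero_le (Lc * Lc), Nat.zero_le (Lc * Lc * Lc)])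
  exact (h.comp (((fst _ _).pair (snd _ _).fst').pair ((rawReverse L).comp (snd _ _).snd'))).congr fun t => by
    show _ = shiftYL t.1 t.2.1 t.2.2
    rw [shiftYL]

/-- **The child on codes.** [folklore] -/
theorem childQLC : CodeFP (pairE kctxE (pairE natE matE)) matE (fun t => childQL t.1 t.2.1 t.2.2) :=
  (shiftYLC.comp ((fst _ _).pair ((snd _ _).fst'.pair (stripXLC.comp (snd _ _).snd'))) :)

/-- **The root search on codes.** [folklore] -/
theorem rootsLKC : CodeFP (pairE kctxE (pairE (rawE natE) matE)) (rawE natE) (fun t => rootsLK t.1 t.2.1 t.2.2) := by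
  have hp : CodeFP (pairE (pairE kctxE L) natE) bitE (fun t => keval t.1.1 t.1.2 t.2 == 0) :=
    (natEq.comp ((kevalC.comp ((fst _ _).fst'.pair ((fst _ _).snd'.pair (snd _ _)))).pair (const _ 0))).congr fun t => by
      rcases Nat.decEq (keval t.1.1 t.1.2 t.2) 0 with h | h <;> simp [h]
  have hA : CodeFP (pairE kctxE (pairE (rawE natE) matE)) L (fun t => atZeroL (stripXL t.2.2)) :=
    atZeroLC.comp (stripXLC.comp (snd _ _).snd')
  exact (((filter hp).comp (((fst _ _).pair hA).pair (snd _ _).fst')).congr fun _ => rfl)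

/-- **The expansion of a node on codes.** [folklore] -/
theorem rrExpandLC : CodeFP (pairE kctxE (pairE (rawE natE) ndE)) (rawE ndE) (fun t => rrExpandL t.1 t.2.1 t.2.2) := by
  have hc : CodeFP (pairE kctxE (pairE (rawE natE) ndE)) kctxE (fun t => t.1) := fst _ _
  have hel : CodeFP (pairE kctxE (pairE (rawE natE) ndE)) (rawE natE) (fun t => t.2.1) := (snd _ _).fst'
  have hp : CodeFP (pairE kctxE (pairE (rawE natE) ndE)) (rawE natE) (fun t => t.2.2.1) := (snd _ _).snd'.fst'
  have hQ : CodeFP (pairE kctxE (pairE (rawE natE) ndE)) matE (fun t => t.2.2.2) := (snd _ _).snd'.snd'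
  have hz : CodeFP (pairE kctxE (pairE (rawE natE) ndE)) bitE (fun t => bIsZero t.2.2.2) := bIsZeroC.comp hQ
  have hroots : CodeFP (pairE kctxE (pairE (rawE natE) ndE)) (rawE natE) (fun t => rootsLK t.1 t.2.1 t.2.2.2) :=
    (rootsLKC.comp (hc.pair (hel.pair hQ)) :)
  -- the child map, context `((c, path), Q)`, item `γ`
  have hg : CodeFP (pairE (pairE (pairE kctxE (rawE natE)) matE) natE) ndE
      (fun t => (t.1.1.2 ++ [t.2], childQL t.1.1.1 t.2 t.1.2)) :=
    (((rawAppend natE).comp ((fst _ _).fst'.snd'.pair ((rawSingleton natE).comp (snd _ _)))).pair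
      (childQLC.comp ((fst _ _).fst'.fst'.pair ((snd _ _).pair (fst _ _).snd'))) :)
  have hch : CodeFP (pairE kctxE (pairE (rawE natE) ndE)) (rawE ndE)
      (fun t => (rootsLK t.1 t.2.1 t.2.2.2).map fun γ => (t.2.2.1 ++ [γ], childQL t.1 γ t.2.2.2)) :=
    ((map hg).comp (((hc.pair hp).pair hQ).pair hroots) :)
  refine ((hz.ite (const _ ([] : List (List ℕ × List (List ℕ)))) hch).congr fun t => ?_)
  rw [rrExpandL]

/-- **Roth–Ruckenstein's levels on codes**: `(c, elems, 1^cap, 1ᵗ, Ql) ↦ rrLevelsL c elems cap t Ql`.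
[cite: RothRuckenstein2000, §V, Fig. 2] [cite: AroraBarak2009, §1.3] -/
theorem rrLevelsLC : CodeFP (pairE kctxE (pairE (rawE natE) (pairE unE (pairE unE matE)))) (rawE ndE)
    (fun t => rrLevelsL t.1 t.2.1 t.2.2.1 t.2.2.2.1 t.2.2.2.2) := by
  -- context `σ = (c, elems, cap, Ql)`
  let σE : (ℕ × ℕ × ℕ) × List ℕ × ℕ × List (List ℕ) → List Bool := pairE kctxE (pairE (rawE natE) (pairE unE matE))
  have hexp : CodeFP (pairE (pairE kctxE (rawE natE)) (rawE ndE)) (rawE ndE) (fun t => t.2.flatMap (rrExpandL t.1.1 t.1.2)) :=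
    ((flatten ndE).comp ((map (σ := (ℕ × ℕ × ℕ) × List ℕ) (eσ := pairE kctxE (rawE natE)) (eα := ndE) (eβ := rawE ndE)
      (g := fun t => rrExpandL t.1.1 t.1.2 t.2) (rrExpandLC.comp ((fst _ _).fst'.pair ((fst _ _).snd'.pair (snd _ _))))))).congr
      fun _ => rfl
  have hstep : CodeFP (pairE σE (pairE unitE (rawE ndE))) (rawE ndE)
      (fun t => (t.2.2.flatMap (rrExpandL t.1.1 t.1.2.1)).take t.1.2.2.1) :=
    ((rawTakeNat ndE).comp ((natOfUn.comp (fst _ _).snd'.snd'.fst').pair (hexp.comp (((fst _ _).fst'.pair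
      (fst _ _).snd'.fst').pair (snd _ _).snd'))) :)
  have hinit : CodeFP σE (rawE ndE) (fun s => [(([] : List ℕ), s.2.2.2)]) :=
    ((rawSingleton ndE).comp ((const _ ([] : List ℕ)).pair (snd _ _).snd'.snd') :)
  have h := foldl (eσ := σE) (eα := unitE) (eβ := rawE ndE)
    (step := fun (s : (ℕ × ℕ × ℕ) × List ℕ × ℕ × List (List ℕ)) (_ : Unit) (F : List (List ℕ × List (List ℕ))) =>
      (F.flatMap (rrExpandL s.1 s.2.1)).take s.2.2.1)
    (init := fun s => [([], s.2.2.2)]) hstep hinit (200 * (X + 1) ^ 5)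
    (fun s l₁ l₂ => by
      obtain ⟨c, elems, cap, Ql⟩ := s
      dsimp only
      set Lc := (pairE σE (rawE unitE) ((c, elems, cap, Ql), l₁ ++ l₂)).length with hLc
      obtain ⟨hF, hnodes⟩ := rrLevelsL_inv c elems cap Ql l₁
      set F := l₁.foldl (fun F (_ : Unit) => (F.flatMap (rrExpandL c elems)).take cap) [([], Ql)]
      obtain ⟨W, f, P⟩ := c
      -- the basic sizes
      have hW : W ≤ Lc := by rw [hLc]; simp only [σE, pairE_apply, length_boolPair, length_unE]; omega
      have hcap : cap ≤ Lc := by rw [hLc]; simp only [σE, pairE_apply, length_boolPair, length_unE]; omega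
      have hQl : (rawE (rawE natE) Ql).length ≤ Lc := by rw [hLc]; simp only [σE, pairE_apply, length_boolPair]; omega
      have hels : (rawE natE elems).length ≤ Lc := by rw [hLc]; simp only [σE, pairE_apply, length_boolPair]; omega
      have hl : l₁.length ≤ Lc := by
        have := length_le_length_rawE unitE (l₁ ++ l₂)
        rw [List.length_append] at this
        rw [hLc]; simp only [σE, pairE_apply, length_boolPair]; omega
      have hQn : Ql.length ≤ Lc := (length_le_length_rawE _ _).trans hQl
      have hQB : bMaxLen Ql ≤ Lc := (bMaxLen_le_code Ql).trans hQl
      have hE : ∀ γ ∈ elems, (natE γ).length ≤ Lc := fun γ hγ => by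
        have := length_item_le_length_rawE natE hγ; omega
      -- every node is short
      have hnd : ∀ nd ∈ F, (pairE (rawE natE) (rawE (rawE natE)) nd).length ≤
          2 * (Lc * (2 * Lc + 2)) + 2 + (Lc + Lc * (2 * ((Lc + Lc * Lc) * (2 * Lc + 4)) + 2)) := by
        intro nd hmem
        obtain ⟨n1, n2, n3, n4, n5⟩ := hnodes nd hmem
        rw [pairE_apply, length_boolPair]
        have hp : (rawE natE nd.1).length ≤ Lc * (2 * Lc + 2) :=
          (length_code_path_le hE n2).trans (Nat.mul_le_mul_right _ (n1.trans hl))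
        have hB : bMaxLen Ql + l₁.length * Ql.length ≤ Lc + Lc * Lc := Nat.add_le_add hQB (Nat.mul_le_mul hl hQn)
        have hq : (rawE (rawE natE) nd.2).length ≤ Lc + Lc * (2 * ((Lc + Lc * Lc) * (2 * Lc + 4)) + 2) := by
          rcases n5 with n5 | n5
          · rw [n5]; exact hQl.trans (Nat.le_add_right _ _)
          · refine (length_code_rows_le (n := Lc) (B := Lc + Lc * Lc) (W := Lc) (n3.le.trans hQn)
              (fun r hr => (n4 r hr).trans hB) (fun r hr x hx => (n5 r hr x hx).trans (Nat.pow_le_pow_right two_pos hW))).trans ?_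
            exact Nat.le_add_left _ _
        omega
      have hFlen : F.length ≤ Lc + 1 := hF.trans (by omega)
      refine ((length_rawE_le_of_forall hnd).trans (Nat.mul_le_mul_right _ hFlen)).trans ?_
      simp only [eval_mul, eval_pow, eval_add, eval_X, eval_ofNat, eval_one]
      nlinarith [Nat.zero_le Lc, Nat.zero_le (Lc * Lc), Nat.zero_le (Lc * Lc * Lc), Nat.zero_le (Lc * Lc * Lc * Lc)])
  exact (h.comp ((((fst _ _).pair ((snd _ _).fst'.pair ((snd _ _).snd'.fst'.pair (snd _ _).snd'.snd'.snd')))).pair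
    (replicateUnit.comp (snd _ _).snd'.snd'.fst'))).congr fun _ => rfl

end Machine

end UmansFP

end Literature.Computability.Complexity

end
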